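import Summits.QuantumFields.YangMills.Theorems.BalabanUVNodesN15KingModelOSExponentialClustering
import Summits.QuantumFields.YangMills.Theorems.BalabanUVNodesN15KingModelRayExactRate

/-!
# BalabanUVNodes ∕ N15 — THE KING-MODEL RUNG (PART Ͳ-e₁): THE ONE-POINT EXPONENTIAL OBSERVABLE `e^{iφ(0)}` SATURATES THE RATE —
# its truncated Osterwalder–Schrader pairing is `e^{−S₂^{ℝ}(0)}(e^{S₂^{ℝ}((t+1)e₀)} − 1) ≥ e^{−S₂^{ℝ}(0)}S₂^{ℝ}((t+1)e₀) > 0`, whose `t`-th root tends to `e^{−√m²}`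
# (Track A, DAG node N15 = NE2; FAN-OUT v1.1 §N15 s3 «KING-MODEL RUNG»; count-neutral)

HONEST FRAMING.  Count-neutral (cell `pub-ymgap`, seat `pub-ymgap-dag-n15-e` g36; `--supports stmt-QuantumFields-27366 --as helper` = K3⁸).  King's `A = 0`, `g = 0` model
([King1986] C. King, Commun. Math. Phys. **102** (1986) 649–677): the FREE massive block field `μ_∞`.  Part Ͳ-d₃ proved `‖T P_{Ω^⊥}‖ ≤ e^{−√m²}` for the transfer operator of `μ_∞`;
this file supplies the farm-checkable half of the CONVERSE: for the single exponential `F(φ) = e^{iφ(0)}` part Ͳ-d₁'s closed form reads ★★ `∫ conj F(φ∘θ)·F(S^tφ) dμ_∞ − (∫ conj F(φ∘θ))(∫F)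
= e^{−S₂^{ℝ}(0)}(e^{S₂^{ℝ}((t+1)e₀)} − 1)` (`θ0 = −e₀`), a POSITIVE REAL number `≥ e^{−S₂^{ℝ}(0)}·S₂^{ℝ}((t+1)e₀)`; and by part Ϸ-t's exact ray rate
(`tendsto_rpow_abs_kingS2Inf_ray`) ★★ `(e^{−S₂^{ℝ}(0)}S₂^{ℝ}((t+1)e₀))^{1∕t} → e^{−√m²}`.  Part Ͳ-e₂ compares this with the spectral bound `≤ ‖ιF‖²·gapNorm^t` and concludes
`gapNorm = e^{−√m²}` exactly.  NOT Bałaban's objects; NOT a node discharge; nothing continuum ∕ `ℝ⁴` ∕ Clay.  0 `sorry`, 0 def; standard axioms.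

WHAT THIS FILE PROVES (kernel).  `single_add_sub_latticeTimeReflection_zero`, ★★ `os_truncated_onePoint_eq`, ★★ `os_truncated_onePoint_norm_ge`, `integral_normSq_onePoint`,
`tendsto_const_rpow_inv_nat`, ★★ `tendsto_rpow_onePoint_lowerBound`.

HONEST SCOPE.  King's free infinite-volume block field (`m² > 0`, every `d`).  N15 untouched; counts unmoved.
Locators (use): [King1986] Thm 2.1 (2.22)–(2.23) p.654, Thm 3.3 (3.6) p.656; Glimm–Jaffe 1987 §6.1, §19.7.
-/

noncomputable section

open scoped BigOperators Topology ComplexConjugate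
open Filter MeasureTheory ProbabilityTheory Finset Complex

namespace Summit.QuantumFields.YangMills.BalabanUVNodes.N15KingModelRung.InfiniteVolume

open Literature.MathematicalPhysics.QuantumFieldTheory (latticeTimeReflection latticeTimeReflection_apply positiveTimeSites positiveTimeEvents latticeTimeShift)
open Literature.Probability.LatticeModels (configReflect configReflect_apply IsBoundedMeasurable)
open Summit.QuantumFields.YangMills.BalabanUVNodes.N15KingModelRung.OptimalDecay
open Summit.QuantumFields.YangMills.BalabanUVNodes.N15KingModelRung.ProperTime

variable {d : ℕ}

/-- `0 + te₀ − θ0 = e₀ + t•e₀` (`θ0 = −e₀`): the shifted reflected separation of the origin from itself is `(t+1)e₀`. [cite: OsterwalderSeiler1978, §2] -/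
theorem single_add_sub_latticeTimeReflection_zero (t : ℕ) :
    (0 : Fin (d + 1) → ℤ) + (Pi.single 0 (t : ℤ) : Fin (d + 1) → ℤ) - latticeTimeReflection (d + 1) 0
      = (Pi.single 0 1 : Fin (d + 1) → ℤ) + (t : ℤ) • (Pi.single 0 (1 : ℤ) : Fin (d + 1) → ℤ) := by
  rw [latticeTimeReflection_apply]
  ext j
  by_cases hj : j = 0
  · subst hj; simp [add_comm]
  · simp [hj]

/-- ★★ **THE TRUNCATED OS PAIRING OF `e^{iφ(0)}` IN CLOSED FORM**: `= e^{−S₂^{ℝ}(0)}·(e^{S₂^{ℝ}(e₀ + te₀)} − 1)` (part Ͳ-d₁ with one term, `s = {0}`, unit frequency).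
[cite: King1986, Thm 2.1 (2.22) p.654; GlimmJaffe1987, §19.7] -/
theorem os_truncated_onePoint_eq {m2 : ℝ} (hm : 0 < m2) (t : ℕ) :
    (∫ ω, conj ((fun ω : (Fin (d + 1) → ℤ) → ℝ => ∑ k : Fin 1, (fun _ => (1 : ℂ)) k
          * Complex.exp (((∑ z ∈ ({0} : Finset (Fin (d + 1) → ℤ)), (fun (_ : Fin 1) (_ : Fin (d + 1) → ℤ) => (1 : ℝ)) k z * ω z : ℝ) : ℂ) * I)) (configReflect (latticeTimeReflection (d + 1)) ω))
        * (fun ω : (Fin (d + 1) → ℤ) → ℝ => ∑ k : Fin 1, (fun _ => (1 : ℂ)) k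
          * Complex.exp (((∑ z ∈ ({0} : Finset (Fin (d + 1) → ℤ)), (fun (_ : Fin 1) (_ : Fin (d + 1) → ℤ) => (1 : ℝ)) k z * ω z : ℝ) : ℂ) * I)) ((latticeTimeShift (d + 1) ℝ)^[t] ω) ∂kingFieldInf m2)
      - (∫ ω, conj ((fun ω : (Fin (d + 1) → ℤ) → ℝ => ∑ k : Fin 1, (fun _ => (1 : ℂ)) k
          * Complex.exp (((∑ z ∈ ({0} : Finset (Fin (d + 1) → ℤ)), (fun (_ : Fin 1) (_ : Fin (d + 1) → ℤ) => (1 : ℝ)) k z * ω z : ℝ) : ℂ) * I)) (configReflect (latticeTimeReflection (d + 1)) ω)) ∂kingFieldInf m2)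
        * (∫ ω, (fun ω : (Fin (d + 1) → ℤ) → ℝ => ∑ k : Fin 1, (fun _ => (1 : ℂ)) k
          * Complex.exp (((∑ z ∈ ({0} : Finset (Fin (d + 1) → ℤ)), (fun (_ : Fin 1) (_ : Fin (d + 1) → ℤ) => (1 : ℝ)) k z * ω z : ℝ) : ℂ) * I)) ω ∂kingFieldInf m2)
      = ((Real.exp (-kingS2Inf (d := d) m2 0) * (Real.exp (kingS2Inf m2 ((Pi.single 0 1 : Fin (d + 1) → ℤ) + (t : ℤ) • (Pi.single 0 (1 : ℤ) : Fin (d + 1) → ℤ))) - 1) : ℝ) : ℂ) := by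
  rw [os_truncated_trigPoly_eq hm (fun _ : Fin 1 => (1 : ℂ)) {0} (fun _ _ => (1 : ℝ)) t]
  simp only [Finset.univ_unique, Fin.default_eq_zero, Finset.sum_singleton, map_one, one_mul, sub_zero,
    single_add_sub_latticeTimeReflection_zero]
  rw [← Complex.ofReal_one, ← Complex.ofReal_sub, ← Complex.ofReal_mul, ← Complex.ofReal_mul]
  congr 1
  rw [← Real.exp_add]
  ring_nf

/-- ★★ **…AND IT IS A POSITIVE REAL `≥ e^{−S₂^{ℝ}(0)}·S₂^{ℝ}(e₀ + te₀)`** (`e^x − 1 ≥ x`, `S₂^{ℝ} > 0`). [cite: King1986, Thm 2.1 (2.23) p.654] -/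
theorem os_truncated_onePoint_norm_ge (m2 : ℝ) (t : ℕ) :
    Real.exp (-kingS2Inf (d := d) m2 0) * kingS2Inf m2 ((Pi.single 0 1 : Fin (d + 1) → ℤ) + (t : ℤ) • (Pi.single 0 (1 : ℤ) : Fin (d + 1) → ℤ))
      ≤ ‖((Real.exp (-kingS2Inf (d := d) m2 0) * (Real.exp (kingS2Inf m2 ((Pi.single 0 1 : Fin (d + 1) → ℤ) + (t : ℤ) • (Pi.single 0 (1 : ℤ) : Fin (d + 1) → ℤ))) - 1) : ℝ) : ℂ)‖ := by
  rw [Complex.norm_real, Real.norm_eq_abs]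
  refine le_trans ?_ (le_abs_self _)
  refine mul_le_mul_of_nonneg_left ?_ (Real.exp_nonneg _)
  linarith [Real.add_one_le_exp (kingS2Inf m2 ((Pi.single 0 1 : Fin (d + 1) → ℤ) + (t : ℤ) • (Pi.single 0 (1 : ℤ) : Fin (d + 1) → ℤ)))]

/-- `∫ ‖e^{iφ(0)}‖² dμ_∞ = 1`. [folklore] -/
theorem integral_normSq_onePoint {m2 : ℝ} (hm : 0 < m2) :
    ∫ ω, ‖(fun ω : (Fin (d + 1) → ℤ) → ℝ => ∑ k : Fin 1, (fun _ => (1 : ℂ)) k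
        * Complex.exp (((∑ z ∈ ({0} : Finset (Fin (d + 1) → ℤ)), (fun (_ : Fin 1) (_ : Fin (d + 1) → ℤ) => (1 : ℝ)) k z * ω z : ℝ) : ℂ) * I)) ω‖ ^ 2 ∂kingFieldInf m2 = 1 := by
  haveI := isProbabilityMeasure_kingFieldInf (d := d) hm
  have h : ∀ ω : (Fin (d + 1) → ℤ) → ℝ, ‖(fun ω : (Fin (d + 1) → ℤ) → ℝ => ∑ k : Fin 1, (fun _ => (1 : ℂ)) k
      * Complex.exp (((∑ z ∈ ({0} : Finset (Fin (d + 1) → ℤ)), (fun (_ : Fin 1) (_ : Fin (d + 1) → ℤ) => (1 : ℝ)) k z * ω z : ℝ) : ℂ) * I)) ω‖ ^ 2 = 1 := fun ω => by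
    simp only [Finset.univ_unique, Fin.default_eq_zero, Finset.sum_singleton, one_mul, Complex.norm_exp_ofReal_mul_I, one_pow]
  simp_rw [h]
  simp

/-- `K^{1∕t} → 1` (`K > 0`). [folklore] -/
theorem tendsto_const_rpow_inv_nat {K : ℝ} (hK : 0 < K) : Tendsto (fun t : ℕ => K ^ ((t : ℝ)⁻¹)) atTop (𝓝 1) := by
  have h : (fun t : ℕ => K ^ ((t : ℝ)⁻¹)) = fun t : ℕ => Real.exp (Real.log K / (t : ℝ)) := by
    funext t
    rw [Real.rpow_def_of_pos hK, div_eq_mul_inv]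
  rw [h, ← Real.exp_zero]
  exact (Real.continuous_exp.tendsto 0).comp (tendsto_const_div_atTop_nhds_zero_nat (Real.log K))

/-- ★★ **THE LOWER BOUND SATURATES THE RATE**: `(e^{−S₂^{ℝ}(0)}·S₂^{ℝ}(e₀ + te₀))^{1∕t} → e^{−√m²}` (part Ϸ-t's exact ray rate along the time axis).
[cite: King1986, Thm 3.3 (3.6) p.656, Thm 2.1 (2.22) p.654] -/
theorem tendsto_rpow_onePoint_lowerBound {m2 : ℝ} (hm : 0 < m2) :
    Tendsto (fun t : ℕ => (Real.exp (-kingS2Inf (d := d) m2 0) * kingS2Inf m2 ((Pi.single 0 1 : Fin (d + 1) → ℤ) + (t : ℤ) • (Pi.single 0 (1 : ℤ) : Fin (d + 1) → ℤ))) ^ ((t : ℝ)⁻¹))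
      atTop (𝓝 (Real.exp (-Real.sqrt m2))) := by
  have h1 := tendsto_const_rpow_inv_nat (Real.exp_pos (-kingS2Inf (d := d) m2 0))
  have h2 := tendsto_rpow_abs_kingS2Inf_ray (d := d) hm (Pi.single 0 1) 0
  have h := h1.mul h2
  rw [one_mul] at h
  refine h.congr fun t => ?_
  rw [abs_of_pos (kingS2Inf_pos hm _), ← Real.mul_rpow (Real.exp_nonneg _) (kingS2Inf_pos hm _).le]

end Summit.QuantumFields.YangMills.BalabanUVNodes.N15KingModelRung.InfiniteVolume
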